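import Literature.NumberTheory.ComplexMultiplication.CMBalancedDivisorFiniteExtensionHolds
import Literature.NumberTheory.ComplexMultiplication.CMFieldBalancedWeights
import Literature.NumberTheory.ComplexMultiplication.CMDefinedOverQbarHolds
import Literature.AlgebraicGeometry.ComplexMultiplication.CMTypeRealisationOverNumberField
import HarnessLib

/-!
# Row II-1-S5b″ is a theorem: a balanced POLARISED structure of type `(K, Φ)` over a number field

[Shimura1998] G. Shimura, *Abelian Varieties with Complex Multiplication and Modular Functions* (1998), §6.2 Thm. 4 (3)
(p. 44 of the PUP edition; «p. 45» in older tree locators) with §12.4 Prop. 26 (p. 96) and §4.1 Prop. 10 (p. 23).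

WHAT IS PROVED.  `exists_balancedPolarisedStructure_numberField_holds` discharges the named fact
`exists_balancedPolarisedStructure_numberField` (`CMBalancedPolarisedStructureOfType.lean`, row II-1-S5b″ of the cell
`hodgecm-mathlib`): for every CM field `K` and CM type `Φ` there are a number field `k ⊆ ℂ`, a structure `(B₀, ι_B)` of type
`(K, Φ)` over `k` and an AMPLE Cartier divisor `Θ₀` on `B₀` whose complex Weil pairings at every level `ℓ^j` are
`K`-balanced, `ē(ι(a)P, Q) = ē(P, ι(ā)Q)`.

PROOF (entirely from results already in the tree; no analysis, no positivity, no field extension):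
* a structure `(B₀, ι_B)` of type `(K, Φ)` over SOME number field — `exists_isCMTypeRealisationOver_of_prop26` fed with the
  theorem `shimura1998_prop26_definedOverNumberField_holds` ([Shimura1998] §12.4 Prop. 26; `CMDefinedOverQbarHolds.lean`);
* balanced weights `(ε_j, m_j)` of `K` — `IsCMField.exists_balancedWeights` ([Deligne1982] §4–§5; `CMFieldBalancedWeights.lean`);
* an ample `X₀` on `B₀` (`exists_isAmple_symmetric_holds`) and the van Geemen average `Θ₀ := Σ_j m_j • ι_B(ε_j)^* X₀`, which is
  AMPLE and has `ē^{Θ₀,ℂ}(P, Q) = ∏_j ē^{X₀,ℂ}(ι(ε_j)P, ι(ε_j)Q)^{m_j}` — `exists_averagedDivisor`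
  (`CMBalancedDivisorFiniteExtensionHolds.lean` §3; [MumfordAV1970] §20 (3));
* product formula + weight identity ⇒ balanced — `weilPairingLevel_balanced_of_eq_prod` below, the (bal) block of
  `exists_balancedDivisor_of_balancedWeights` (loc. cit. §4) stated once as a lemma so that the ampleness of the average is kept.

## References
* [Shimura1998] §6.2 Thm. 4 (3) p. 44, §12.4 Prop. 26 p. 96, §4.1 Prop. 10 p. 23.
* [Deligne1982] P. Deligne, *Hodge cycles on abelian varieties*, LNM 900 (1982), §4 (4.3)(a), §5 (5.2).
* [MumfordAV1970] D. Mumford, *Abelian Varieties* (1970), §20 (3) (p. 186).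
-/

set_option autoImplicit false

noncomputable section

open scoped nonZeroDivisors NumberField
open CategoryTheory CategoryTheory.Limits NumberField AlgebraicGeometry

namespace Literature.NumberTheory.ComplexMultiplication

open Literature.AlgebraicGeometry.Motives Literature.AlgebraicGeometry.Motives.AbelianVariety

/-! ## §1 Product formula + balanced weights ⇒ balanced pairings -/

section Balanced

variable {K : Type} [Field K] [NumberField K] [IsCMField K] {k' : Type} [Field k'] [Algebra k' ℂ]
  (A₁ : AbelianVariety k') (ι₁ : 𝓞 K →+* End A₁)

/-- **Balanced weights make the averaged pairing `K`-balanced** ([Deligne1982] §4 (4.3)(a) ⇒ [Shimura1998] §6.2 Thm. 4 (3),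
clause (bal)): if the complex Weil pairings of `X` are the weighted product of those of `X₀` along the `ι₁(ε_j)`
(`hX`, the shape produced by `exists_averagedDivisor`) and `(ε_j, m_j)` is a balanced system of weights of `K` (`hWid`:
`Σ_j m_j β(ε_j a, ε_j) = Σ_j m_j β(ε_j, ε_j ā)` for every bi-additive `β`), then `ē^{X,ℂ}(ι(a)P, Q) = ē^{X,ℂ}(P, ι(ā)Q)` at every
level `ℓ^k`.  Proof: apply `hWid` to the bi-additive `β(x, y) := ē^{X₀,ℂ}(ι(x)P, ι(y)Q) ∈ ℂˣ` (bi-additivity from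
`weilPairingLevel_mul_left/right` and `ι(x + y)R = ι(x)R + ι(y)R`) and rewrite both sides through the product formula, using
`ι(xy)R = ι(x)(ι(y)R)`.  This is verbatim the (bal) block of `exists_balancedDivisor_of_balancedWeights`, isolated so that callers
keep the ampleness of the averaged divisor. [cite: Deligne1982, §4 (4.3)(a) and §5 (5.2)] [cite: Shimura1998, §6.2 Thm. 4 (3) p. 44] -/
theorem weilPairingLevel_balanced_of_eq_prod {ι : Type} [Fintype ι] (ε : ι → 𝓞 K) (m : ι → ℕ)
    (hWid : ∀ (G : Type) [AddCommGroup G] (β : 𝓞 K →+ 𝓞 K →+ G) (a : 𝓞 K),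
      ∑ j, m j • β (ε j * a) (ε j) = ∑ j, m j • β (ε j) (ε j * IsCMField.ringOfIntegersComplexConj K a))
    (X₀ X : CartierDivisor A₁.X.left)
    (hX :
        ∀ (πA : (A₁.baseChange ℂ).X.left ⟶ A₁.X.left) (_hπA : πA = pullback.fst A₁.X.hom (bcSpec k' ℂ)) [IsDominant πA]
          (N : ℕ) [IsDominant (Hom.toSchemeHom ((N : ℤ) • 𝟙 (A₁.baseChange ℂ)))]
          (P Q : (A₁.baseChange ℂ).torsionPoints ℂ N),
          (A₁.baseChange ℂ).weilPairingLevel (X.pullback πA) P Q =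
            ∏ j ∈ Finset.univ, (A₁.baseChange ℂ).weilPairingLevel (X₀.pullback πA)
                ⟨AlgPoints.map (((A₁.endBaseChange ℂ).comp ι₁) (ε j) : A₁.baseChange ℂ ⟶ A₁.baseChange ℂ).hom.hom.hom P.1,
                  map_mem_torsionPoints (((A₁.endBaseChange ℂ).comp ι₁) (ε j) : A₁.baseChange ℂ ⟶ A₁.baseChange ℂ) P.2⟩
                ⟨AlgPoints.map (((A₁.endBaseChange ℂ).comp ι₁) (ε j) : A₁.baseChange ℂ ⟶ A₁.baseChange ℂ).hom.hom.hom Q.1,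
                  map_mem_torsionPoints (((A₁.endBaseChange ℂ).comp ι₁) (ε j) : A₁.baseChange ℂ ⟶ A₁.baseChange ℂ) Q.2⟩ ^ m j)
    (πA : (A₁.baseChange ℂ).X.left ⟶ A₁.X.left) (hπA : πA = pullback.fst A₁.X.hom (bcSpec k' ℂ)) [IsDominant πA]
    (ℓ : ℕ) (_hdom : ∀ k : ℕ, IsDominant (Hom.toSchemeHom (((ℓ ^ k : ℕ) : ℤ) • 𝟙 (A₁.baseChange ℂ))))
    (k : ℕ) (a : 𝓞 K) (P Q : (A₁.baseChange ℂ).torsionPoints ℂ ((ℓ ^ k : ℕ) : ℤ)) :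
      (A₁.baseChange ℂ).weilPairingLevel (X.pullback πA)
          ⟨AlgPoints.map (((A₁.endBaseChange ℂ).comp ι₁) a).hom.hom.hom P.1,
            map_mem_torsionPoints (((A₁.endBaseChange ℂ).comp ι₁) a) P.2⟩ Q =
        (A₁.baseChange ℂ).weilPairingLevel (X.pullback πA) P
          ⟨AlgPoints.map (((A₁.endBaseChange ℂ).comp ι₁) (IsCMField.ringOfIntegersComplexConj K a)).hom.hom.hom Q.1,
            map_mem_torsionPoints (((A₁.endBaseChange ℂ).comp ι₁) (IsCMField.ringOfIntegersComplexConj K a)) Q.2⟩ := by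
  classical
  haveI : IsDominant (Hom.toSchemeHom (((ℓ ^ k : ℕ) : ℤ) • 𝟙 (A₁.baseChange ℂ))) := _hdom k
  -- the points `ι(x) R` and their algebra
  have hmul : ∀ (x y : 𝓞 K) (R : (A₁.baseChange ℂ).torsionPoints ℂ ((ℓ ^ k : ℕ) : ℤ)),
      (⟨AlgPoints.map (((A₁.endBaseChange ℂ).comp ι₁) (x * y)).hom.hom.hom R.1,
          map_mem_torsionPoints (((A₁.endBaseChange ℂ).comp ι₁) (x * y)) R.2⟩ :
          (A₁.baseChange ℂ).torsionPoints ℂ ((ℓ ^ k : ℕ) : ℤ)) =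
        ⟨AlgPoints.map (((A₁.endBaseChange ℂ).comp ι₁) x).hom.hom.hom
            (AlgPoints.map (((A₁.endBaseChange ℂ).comp ι₁) y).hom.hom.hom R.1),
          map_mem_torsionPoints (((A₁.endBaseChange ℂ).comp ι₁) x)
            (map_mem_torsionPoints (((A₁.endBaseChange ℂ).comp ι₁) y) R.2)⟩ :=
    fun x y R => Subtype.ext (map_hom_map_mul ((A₁.endBaseChange ℂ).comp ι₁) x y R.1)
  have hadd : ∀ (x y : 𝓞 K) (R : (A₁.baseChange ℂ).torsionPoints ℂ ((ℓ ^ k : ℕ) : ℤ)),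
      (⟨AlgPoints.map (((A₁.endBaseChange ℂ).comp ι₁) (x + y)).hom.hom.hom R.1,
          map_mem_torsionPoints (((A₁.endBaseChange ℂ).comp ι₁) (x + y)) R.2⟩ :
          (A₁.baseChange ℂ).torsionPoints ℂ ((ℓ ^ k : ℕ) : ℤ)) =
        ⟨AlgPoints.map (((A₁.endBaseChange ℂ).comp ι₁) x).hom.hom.hom R.1,
            map_mem_torsionPoints (((A₁.endBaseChange ℂ).comp ι₁) x) R.2⟩ *
          ⟨AlgPoints.map (((A₁.endBaseChange ℂ).comp ι₁) y).hom.hom.hom R.1,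
            map_mem_torsionPoints (((A₁.endBaseChange ℂ).comp ι₁) y) R.2⟩ :=
    fun x y R => Subtype.ext (map_hom_map_add ((A₁.endBaseChange ℂ).comp ι₁) x y R.1)
  -- the bi-multiplicative `β(x, y) = ē^{X₀,ℂ}(ι(x) P, ι(y) Q)`, valued in `ℂˣ`
  let e : 𝓞 K → 𝓞 K → ℂˣ := fun x y => Units.mk0
    ((A₁.baseChange ℂ).weilPairingLevel (X₀.pullback πA)
      ⟨AlgPoints.map (((A₁.endBaseChange ℂ).comp ι₁) x).hom.hom.hom P.1,
        map_mem_torsionPoints (((A₁.endBaseChange ℂ).comp ι₁) x) P.2⟩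
      ⟨AlgPoints.map (((A₁.endBaseChange ℂ).comp ι₁) y).hom.hom.hom Q.1,
        map_mem_torsionPoints (((A₁.endBaseChange ℂ).comp ι₁) y) Q.2⟩)
    (weilPairingLevel_ne_zero _ _ _)
  have he : ∀ x y, (e x y : ℂ) = (A₁.baseChange ℂ).weilPairingLevel (X₀.pullback πA)
      ⟨AlgPoints.map (((A₁.endBaseChange ℂ).comp ι₁) x).hom.hom.hom P.1,
        map_mem_torsionPoints (((A₁.endBaseChange ℂ).comp ι₁) x) P.2⟩
      ⟨AlgPoints.map (((A₁.endBaseChange ℂ).comp ι₁) y).hom.hom.hom Q.1,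
        map_mem_torsionPoints (((A₁.endBaseChange ℂ).comp ι₁) y) Q.2⟩ := fun x y => rfl
  have he_left : ∀ x x' y, e (x + x') y = e x y * e x' y := fun x x' y => by
    apply Units.ext
    rw [Units.val_mul, he, he, he, hadd, weilPairingLevel_mul_left]
  have he_right : ∀ x y y', e x (y + y') = e x y * e x y' := fun x y y' => by
    apply Units.ext
    rw [Units.val_mul, he, he, he, hadd, weilPairingLevel_mul_right]
  let β : 𝓞 K →+ 𝓞 K →+ Additive ℂˣ :=
    AddMonoidHom.mk' (fun x => AddMonoidHom.mk' (fun y => Additive.ofMul (e x y)) (fun y y' => by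
        change Additive.ofMul (e x (y + y')) = Additive.ofMul (e x y) + Additive.ofMul (e x y')
        rw [he_right]; rfl))
      (fun x x' => by
        refine AddMonoidHom.ext fun y => ?_
        change Additive.ofMul (e (x + x') y) = Additive.ofMul (e x y) + Additive.ofMul (e x' y)
        rw [he_left]; rfl)
  have hβ : ∀ x y, β x y = Additive.ofMul (e x y) := fun _ _ => rfl
  have hid := congrArg (fun z : Additive ℂˣ => ((Additive.toMul z : ℂˣ) : ℂ)) (hWid (Additive ℂˣ) β a)
  simp only [toMul_sum, toMul_nsmul, hβ, toMul_ofMul, Units.coe_prod, Units.val_pow_eq_pow_val, he] at hid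
  -- both sides through the product formula
  rw [hX πA hπA (ℓ ^ k) _ Q, hX πA hπA (ℓ ^ k) P _]
  simp only [← hmul]
  exact hid

end Balanced

/-! ## §2 The discharge of row II-1-S5b″ -/

/-- **Row II-1-S5b″ holds** ([Shimura1998] §6.2 Thm. 4 (3) with §12.4 Prop. 26): for every CM field `K` and CM type `Φ` there
are a number field `k ⊆ ℂ`, a structure `(B₀, ι_B)` of type `(K, Φ)` over `k` (`IsCMTypeRealisationOver`) and an ample Cartier
divisor `Θ₀` on `B₀` whose complex Weil pairings are `K`-balanced at every level `ℓ^j` — the statement of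
`exists_balancedPolarisedStructure_numberField`, verbatim.  Proof: `(B₀, ι_B)` over a number field by Prop. 26
(`exists_isCMTypeRealisationOver_of_prop26 shimura1998_prop26_definedOverNumberField_holds`); balanced weights of `K`
(`IsCMField.exists_balancedWeights`); `Θ₀ :=` the average of an ample `X₀` (`exists_isAmple_symmetric_holds`,
`exists_averagedDivisor`: ample, product formula); balanced by `weilPairingLevel_balanced_of_eq_prod`.
[cite: Shimura1998, §6.2 Thm. 4 (3) p. 44; §12.4 Prop. 26 p. 96] [cite: Deligne1982, §4 (4.3)(a)] -/
theorem exists_balancedPolarisedStructure_numberField_holds : exists_balancedPolarisedStructure_numberField := by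
  intro K _ _ _ Φ
  classical
  obtain ⟨k, hk₁, hk₂, hk₃, B₀, ιB, hB⟩ :=
    Literature.AlgebraicGeometry.ComplexMultiplication.exists_isCMTypeRealisationOver_of_prop26
      shimura1998_prop26_definedOverNumberField_holds Φ
  obtain ⟨ι, _, ε, m, hne, hε, hm, hWid⟩ := IsCMField.exists_balancedWeights K
  -- an ample divisor on `B₀` and its balanced average (ample, product formula)
  obtain ⟨X₀, hX₀, -⟩ := (exists_isAmple_symmetric_holds : B₀.exists_isAmple_symmetric)
  obtain ⟨Θ₀, hΘa, hΘ⟩ := exists_averagedDivisor B₀ ιB X₀ hX₀ ε hε m hm Finset.univ Finset.univ_nonempty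
  refine ⟨k, hk₁, hk₂, hk₃, B₀, ιB, hB, Θ₀, hΘa, ?_⟩
  intro πB hπB _ ℓ _hℓ _hdom j a P Q
  exact weilPairingLevel_balanced_of_eq_prod B₀ ιB ε m hWid X₀ Θ₀ hΘ πB hπB ℓ _hdom j a P Q

end Literature.NumberTheory.ComplexMultiplication

end
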